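import Summits.KontsevichZagierPeriods.KontsevichZagierPeriods.Theorems.SoloInformedAlgRealPiece
import HarnessLib
import HarnessLib.Audit

/-!
# SoloInformed — the period conjecture for rational integrands with REAL ALGEBRAIC coefficients, dimension 1, bounded domains

Solo programme `solo-KontsevichZagierPeriods-informed`, session s112, file 17.

Let `K = algebraicClosure ℚ ℝ` be the field of real algebraic numbers.  The class
`SoloInformedIsKRationalOne r` is Kontsevich–Zagier's literal rational shape with `K` in place of
`ℚ`: the integrand of `r = [D, f]` (`dim D = 1`) is `P/Q` on `D` for some `P, Q ∈ K[X]` with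
`Q ≠ 0` on `D` (poles on `∂D` allowed, as in `IsRational`).  It contains every rational
representation of dimension `1` (`soloInformed_isKRationalOne_of_isRational`).

**Theorem** (`soloInformed_segSpan_of_isKRationalOne_isBounded`, `soloInformed_kzp_isKRationalOne_isBounded`,
`soloInformed_sum_zsmul_of_mem_relations_K`).  Every member of the class with BOUNDED domain lies in
the span of points and segments; hence two members with equal values are KZ-equivalent, a member and
any rational representation of dimension `≤ 1` with equal values are KZ-equivalent, and vanishing
`ℤ`-combinations of values of members are relations — the Kontsevich–Zagier period conjecture for
absolutely convergent `∫_D N(x)/M(x) dx`, `N, M` real polynomials with real algebraic coefficients,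
`M ≠ 0` on the bounded `ℚ`-semialgebraic `D ⊆ ℝ` (KZ, *Periods* §1.1: "rational" → "algebraic",
one variable, inside the move calculus).

Proof: the cylindrical-decomposition skeleton of file 10 with the `K`-piece lemma of file 16
(lowest terms over `K`, no integrable poles, the algebraic piece lemma of file 14).  Unbounded
domains are not treated (the projective charts preserve the class on paper; the tree's
compactification lemma is stated for `IsRational`).

References: M. Kontsevich, D. Zagier, *Periods* (2001), §1.1–1.2; A. Baker, *Transcendental Number
Theory* (1975), Thm. 2.1; J. Viu-Sos (2021), §2.3.
-/

noncomputable section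

open scoped BigOperators Polynomial

namespace Summit.KontsevichZagierPeriods.KontsevichZagierPeriods.Theorems

open Set MeasureTheory
open Literature.ModelTheory.ExponentialFields
open Literature.NumberTheory.Transcendental Literature.NumberTheory.Transcendental.KZ

/-- **Bounded representations with integrand `P/Q`, `P, Q ∈ K[X]`, `Q ≠ 0` on the domain, lie in
the span of points and segments.** [Kontsevich–Zagier 2001, §1.1–1.2; this work] -/
theorem soloInformed_segSpan_of_KFun_isBounded_one (r : IntegralRep 1)
    {P Q : (algebraicClosure ℚ ℝ)[X]}
    (hq' : ∀ x ∈ r.domain, (Polynomial.aeval (x 0) Q : ℝ) ≠ 0)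
    (hpq' : EqOn r.integrand
      (fun x => (Polynomial.aeval (x 0) P : ℝ) / Polynomial.aeval (x 0) Q) r.domain)
    (hb : Bornology.IsBounded r.domain) :
    of r ∈ soloInformedSegSpan := by
  classical
  -- an adapted cylindrical decomposition of the line
  obtain ⟨𝒮, hcd, hF⟩ := IsSemialgebraic.exists_cylindricalDecomposition_holds (k := ℚ)
    ({r.domain} : Finset (Set (Fin 1 → ℝ))) (by simpa using r.isSemialgebraic_domain)
  obtain ⟨𝒞, h𝒞𝒮, h𝒞K⟩ := hF r.domain (by simp)
  obtain ⟨-, hsemi, 𝒮₀, h0, hstack⟩ := isCylindricalDecomposition_succ.1 hcd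
  have h0' : 𝒮₀ = {univ} := isCylindricalDecomposition_zero.1 h0
  subst h0'
  obtain ⟨l, ξ, -, hsa, hmono, hcells⟩ := hstack
  -- the sections over the point and their values
  set pt : Fin 0 → ℝ := Fin.elim0 with hpt
  set L := l univ with hL
  set ζ : Fin L → (Fin 0 → ℝ) → ℝ := ξ univ with hζ
  set c : Fin L → ℝ := fun j => ζ j pt with hc
  have hcmono : StrictMono c := hmono univ (by simp) pt (mem_univ _)
  have hinit : ∀ w : Fin 1 → ℝ, Fin.init w = pt := fun w => Subsingleton.elim _ _
  -- the graph cells are the points `c j`, which are therefore algebraic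
  have hgraph : ∀ j : Fin L, graphOver univ (ζ j) = {fun _ => c j} := fun j => by
    ext w
    rw [mem_graphOver_iff, hinit w, mem_singleton_iff]
    simp only [mem_univ, true_and]
    constructor
    · intro h; rw [KZ.eq_const_apply_zero w]; exact congrArg (fun t => fun _ : Fin 1 => t) h
    · intro h; rw [h]
  have halg : ∀ j : Fin L, IsAlgebraic ℚ (c j) := fun j => by
    have hmem : graphOver univ (ζ j) ∈ 𝒮 := (hcells _).2 ⟨univ, by simp, Or.inl ⟨j, rfl⟩⟩
    have hs := hsemi _ hmem
    rw [hgraph j] at hs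
    exact isAlgebraic_of_mem_of_finite hs (finite_singleton _) (mem_singleton _)
  -- the index set: bands contained in the (bounded) domain; they are interior bands
  let ι := {j : Fin (L + 1) // bandOver univ ζ j ∈ 𝒞}
  have hsubD : ∀ i : ι, bandOver univ ζ i.1 ⊆ r.domain := fun i =>
    h𝒞K ▸ subset_sUnion_of_mem i.2
  have hne0 : ∀ i : ι, i.1 ≠ 0 := fun i h =>
    soloInformed_band_zero_not_isBounded ζ (hb.subset (h ▸ hsubD i))
  have hnel : ∀ i : ι, i.1 ≠ Fin.last L := fun i h =>
    soloInformed_band_last_not_isBounded ζ (hb.subset (h ▸ hsubD i))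
  set lo : ι → ℝ := fun i => c (i.1.pred (hne0 i)) with hlo
  set hi : ι → ℝ := fun i => c (i.1.castPred (hnel i)) with hhi
  have hlohi : ∀ i, lo i < hi i := fun i => hcmono (by
    rw [Fin.lt_def, Fin.val_pred, Fin.coe_castPred]
    have h1 : (i.1 : ℕ) ≠ 0 := fun h => hne0 i (Fin.ext h)
    omega)
  have hband : ∀ i : ι, bandOver univ ζ i.1 = {w | ∀ k, lo i < w k ∧ w k < hi i} := fun i => by
    ext w
    rw [mem_bandOver_iff, bandLower_of_ne_zero ζ i.1 (hne0 i), bandUpper_of_ne_last ζ i.1 (hnel i),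
      hinit w, EReal.coe_lt_coe_iff, EReal.coe_lt_coe_iff]
    simp only [mem_univ, true_and, mem_setOf_eq]
    constructor
    · rintro h ⟨k, hk⟩
      have hk0 : k = 0 := by omega
      subst hk0
      exact h
    · intro h
      exact h (Fin.last 0)
  have hbandS : ∀ i : ι, IsSemialgebraic ℚ {w : Fin 1 → ℝ | ∀ k, lo i < w k ∧ w k < hi i} :=
    fun i => hband i ▸ hsemi _ (h𝒞𝒮 i.2)
  have hbandD : ∀ i : ι, {w : Fin 1 → ℝ | ∀ k, lo i < w k ∧ w k < hi i} ⊆ r.domain :=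
    fun i => hband i ▸ hsubD i
  -- the pieces
  set R : ι → IntegralRep 1 := fun i => r.restrict _ (hbandS i) (hbandD i) with hR
  have hpieces : ∀ i, of (R i) ∈ soloInformedSegSpan := fun i =>
    soloInformed_restrict_interval_mem_segSpan_K r hq' hpq' (hlohi i) (halg _) (halg _) (hbandS i)
      (hbandD i)
  -- rule (1) over the almost-partition of the domain by the bands
  have hpart : of r - ∑ i, of (R i) ∈ relations := by
    refine KZ.of_sub_sum_of_mem_relations Finset.univ r R (fun i _ => ?_) (fun i _ _ _ => rfl)
      ?_ ?_
    · rw [show (R i).domain \ r.domain = ∅ from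
        Set.eq_empty_of_subset_empty fun w hw => hw.2 (hbandD i hw.1), measure_empty]
    · -- the uncovered part of the domain consists of graph cells: finitely many points
      refine measure_mono_null (fun w hw => ?_)
        ((Set.finite_range fun j : Fin L => (fun _ => c j : Fin 1 → ℝ)).measure_zero volume)
      obtain ⟨hwD, hwU⟩ := hw
      have hwD' : w ∈ ⋃₀ (𝒞 : Set (Set (Fin 1 → ℝ))) := by rw [h𝒞K]; exact hwD
      obtain ⟨T, hT𝒞, hwT⟩ := mem_sUnion.1 hwD'
      obtain ⟨S, hS, hT⟩ := (hcells T).1 (h𝒞𝒮 hT𝒞)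
      rw [Finset.mem_singleton] at hS
      subst hS
      rcases hT with ⟨j, rfl⟩ | ⟨j, rfl⟩
      · rw [hgraph j, mem_singleton_iff] at hwT
        exact ⟨j, hwT.symm⟩
      · refine (hwU ?_).elim
        refine mem_iUnion₂.2 ⟨⟨j, hT𝒞⟩, Finset.mem_univ _, ?_⟩
        show w ∈ {w : Fin 1 → ℝ | ∀ k, lo ⟨j, hT𝒞⟩ < w k ∧ w k < hi ⟨j, hT𝒞⟩}
        rw [← hband ⟨j, hT𝒞⟩]
        exact hwT
    · -- distinct interior bands are disjoint
      intro i _ j _ hij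
      suffices h : {w : Fin 1 → ℝ | ∀ k, lo i < w k ∧ w k < hi i} ∩
          {w | ∀ k, lo j < w k ∧ w k < hi j} = ∅ by
        show volume ({w : Fin 1 → ℝ | ∀ k, lo i < w k ∧ w k < hi i} ∩
          {w | ∀ k, lo j < w k ∧ w k < hi j}) = 0
        rw [h]; exact measure_empty
      ext w
      simp only [mem_inter_iff, mem_setOf_eq, mem_empty_iff_false, iff_false, not_and]
      intro hwi hwj
      have hij' : i.1 ≠ j.1 := fun h => hij (Subtype.ext h)
      rcases lt_or_gt_of_ne hij' with hlt | hgt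
      · have hle : hi i ≤ lo j := hcmono.monotone (by
          rw [Fin.le_def, Fin.val_pred, Fin.coe_castPred]; rw [Fin.lt_def] at hlt; omega)
        linarith [(hwi 0).2, (hwj 0).1]
      · have hle : hi j ≤ lo i := hcmono.monotone (by
          rw [Fin.le_def, Fin.val_pred, Fin.coe_castPred]; rw [Fin.lt_def] at hgt; omega)
        linarith [(hwj 0).2, (hwi 0).1]
  exact soloInformed_mem_segSpan_of_sub_mem hpart
    (soloInformed_sum_mem_segSpan _ fun i _ => hpieces i)

/-- KZ's rational shape with REAL ALGEBRAIC coefficients, dimension `1`: the integrand is `P/Q` on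
the domain for some `P, Q ∈ K[X]` (`K = algebraicClosure ℚ ℝ`) with `Q ≠ 0` on the domain. -/
def SoloInformedIsKRationalOne (r : IntegralRep 1) : Prop :=
  ∃ P Q : (algebraicClosure ℚ ℝ)[X], (∀ x ∈ r.domain, (Polynomial.aeval (x 0) Q : ℝ) ≠ 0) ∧
    EqOn r.integrand (fun x => (Polynomial.aeval (x 0) P : ℝ) / Polynomial.aeval (x 0) Q) r.domain

/-- Rational representations of dimension `1` are in the class. -/
theorem soloInformed_isKRationalOne_of_isRational (r : IntegralRep 1) (hr : r.IsRational) :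
    SoloInformedIsKRationalOne r := by
  obtain ⟨p, q, hq, hpq⟩ := hr
  have hconv : ∀ f : MvPolynomial (Fin 1) ℚ, ∃ F : (algebraicClosure ℚ ℝ)[X], ∀ x : Fin 1 → ℝ,
      MvPolynomial.aeval x f = (Polynomial.aeval (x 0) F : ℝ) := fun f => by
    refine ⟨(MvPolynomial.aeval (fun _ : Fin 1 => (Polynomial.X : ℚ[X])) f).map
      (algebraMap ℚ (algebraicClosure ℚ ℝ)), fun x => ?_⟩
    have hx : x = fun _ => x 0 := KZ.eq_const_apply_zero x
    rw [Polynomial.aeval_map_algebraMap]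
    conv_lhs => rw [hx]
    rw [← AlgHom.comp_apply, MvPolynomial.comp_aeval]
    simp
  obtain ⟨P, hP⟩ := hconv p
  obtain ⟨Q, hQ⟩ := hconv q
  refine ⟨P, Q, fun x hx h => hq x hx ((hQ x).trans h), fun x hx => ?_⟩
  rw [hpq hx]
  show MvPolynomial.aeval x p / MvPolynomial.aeval x q = _
  rw [hP x, hQ x]

/-- **Members of the class with bounded domain lie in the span of points and segments.**
[this work] -/
theorem soloInformed_segSpan_of_isKRationalOne_isBounded (r : IntegralRep 1)
    (hr : SoloInformedIsKRationalOne r) (hb : Bornology.IsBounded r.domain) :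
    of r ∈ soloInformedSegSpan := by
  obtain ⟨P, Q, hQ, hpq⟩ := hr
  exact soloInformed_segSpan_of_KFun_isBounded_one r hQ hpq hb

/-- **The Kontsevich–Zagier period conjecture for rational integrands with real algebraic
coefficients, dimension `1`, bounded domains** (unconditional): equal values ⇒ KZ-equivalent, within
the class and against every rational representation of dimension `≤ 1` (any domain).
[Kontsevich–Zagier 2001, §1.2 Question 1; this work] -/
theorem soloInformed_kzp_isKRationalOne_isBounded (r r' : IntegralRep 1)
    (hr : SoloInformedIsKRationalOne r) (hr' : SoloInformedIsKRationalOne r')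
    (hb : Bornology.IsBounded r.domain) (hb' : Bornology.IsBounded r'.domain) :
    (r.value = r'.value → Equivalent r r') ∧
      ∀ {n : ℕ} (hn : n ≤ 1) (r₀ : IntegralRep n), r₀.IsRational → r.value = r₀.value →
        Equivalent r r₀ :=
  ⟨fun hv => soloInformed_equivalent_of_mem_segSpan
      (soloInformed_segSpan_of_isKRationalOne_isBounded r hr hb)
      (soloInformed_segSpan_of_isKRationalOne_isBounded r' hr' hb') hv,
    fun hn r₀ hr₀ hv => soloInformed_equivalent_of_mem_segSpan
      (soloInformed_segSpan_of_isKRationalOne_isBounded r hr hb)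
      (soloInformed_of_mem_segSpan_of_isRational hn r₀ hr₀) hv⟩

/-- **Kernel form over `K`**: a `ℤ`-combination of bounded members of the class with vanishing
total value is a Kontsevich–Zagier relation; combined with `KZ.scale` (file 12) the same holds for
`K`-linear combinations. [this work] -/
theorem soloInformed_sum_zsmul_of_mem_relations_K {ι : Type*} (s : Finset ι)
    (r : ι → IntegralRep 1) (c : ι → ℤ) (hr : ∀ i ∈ s, SoloInformedIsKRationalOne (r i))
    (hb : ∀ i ∈ s, Bornology.IsBounded (r i).domain)
    (h0 : ∑ i ∈ s, (c i : ℝ) * (r i).value = 0) :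
    ∑ i ∈ s, c i • of (r i) ∈ relations := by
  refine soloInformed_mem_relations_of_mem_segSpan
    (AddSubgroup.sum_mem _ fun i hi => AddSubgroup.zsmul_mem _
      (soloInformed_segSpan_of_isKRationalOne_isBounded (r i) (hr i hi) (hb i hi)) _) ?_
  rw [map_sum]
  simpa only [map_zsmul, eval_of, zsmul_eq_mul] using h0

/-- `K`-LINEAR kernel form: real algebraic scalars `a_i`, bounded members `r_i` of the class,
`Σ a_i value(r_i) = 0` ⇒ `Σ [D_i, a_i f_i] ∈ relations`. [this work] -/
theorem soloInformed_sum_constMul_of_mem_relations_K {ι : Type*} (s : Finset ι)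
    (r : ι → IntegralRep 1) (a : ι → ℝ) (ha : ∀ i, IsAlgebraic ℚ (a i))
    (hr : ∀ i ∈ s, SoloInformedIsKRationalOne (r i))
    (hb : ∀ i ∈ s, Bornology.IsBounded (r i).domain)
    (h0 : ∑ i ∈ s, a i * (r i).value = 0) :
    ∑ i ∈ s, of ((r i).constMul (a i) (ha i)) ∈ relations := by
  refine soloInformed_mem_relations_of_mem_segSpan
    (soloInformed_sum_mem_segSpan _ fun i hi => ?_) ?_
  · rw [← scale_of]
    exact soloInformed_scale_mem_segSpan (ha i)
      (soloInformed_segSpan_of_isKRationalOne_isBounded (r i) (hr i hi) (hb i hi))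
  · rw [map_sum]
    simpa only [eval_of, IntegralRep.value_constMul] using h0

end Summit.KontsevichZagierPeriods.KontsevichZagierPeriods.Theorems
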